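import Mathlib
import Summits.ResolutionOfSingularities.ResolutionOfSingularities.Theorems.WildQuotientsWildQuotientResolutionQuarter1123WeightZero
import Summits.ResolutionOfSingularities.ResolutionOfSingularities.Theorems.WildQuotientsWildQuotientResolutionJordanFiveX0ChartTools

/-!
# RUNG V5 brick `HP₀`, (A2): the root-chart images and the generator ratios generate the weight-`0` part

(crux stmt-ResolutionOfSingularities-15640 `WildQuotients.WildQuotientResolution`, line `Sketch`,
sector `|G| = p`; chain w45c RUNG V5, β‴ `HP₀` assembly — res-L1-w45c-plan-1 RULING 13:55:27Z
«(A2) `JordanFive.adjoin_root5_eq_weightZero` = stub-4»; input of res-L1-w45c-stub-5's (A1)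
`JordanFive.exists_ringEquiv_blowupChart0_weightZero` (the chart-`0` sections ring of `Bl_{I₁₂} 𝔸ⁿ`
`≅` the weight-`0` part). [OURS · L1 W4.5c] — NOT a statement of any manuscript; replaces the role
of no printed item. Prover res-L1-w45c-stub-4 (gen 4). Def-free.)

With `ψ₀` the root substitution of the `μ₄` vertex chart (`x_a ↦ x_a⁴`, `x_b ↦ x_a³x_b`,
`x_c ↦ x_a²x_c`, `x_d ↦ x_ax_d`, passengers fixed — res-type-036 / res-L1-w45c-stub-2's letters,
`JordanFive.root5_X_*`, `aeval_root5_gens12`) and the RATIO monomials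
`r_j = x_a^{4α+3β+2γ+δ−12} x_b^β x_c^γ x_d^δ` of the forty generators `g_j = x^{exps12 j}` of `I₁₂`
(`ψ₀(g_j) = x_a¹² · r_j`):

* `isWeightedHomogeneous_zero_of_four_dvd` — `x_a^i x_b^j x_c^l x_d^m` has `μ₄`-weight `0` when
  `4 ∣ i + j + 2l + 3m`;
* `adjoin_root5_eq_weightZero` — **`k[ψ₀(x_i) : i] [r_j : j] = {f | IsWeightedHomogeneous w f 0}`**
  (`w = (1,1,2,3)` on `(a,b,c,d)`, `0` on passengers): by res-type-036's
  `Quarter1123.mem_adjoin_iff_isWeightedHomogeneous_zero`, the thirteen Hilbert monomials of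
  `¼(1,1,2,3)` being `ψ₀(x_a), ψ₀(x_b), ψ₀(x_c), ψ₀(x_d)` and `r_39, r_35, r_1, r_34, r_8, r_5, r_4,
  r_6, r_7`.
-/

-- single-problem summit: the doubled namespace component `ResolutionOfSingularities` is forced
set_option linter.dupNamespace false

noncomputable section

open MvPolynomial

namespace Summit.ResolutionOfSingularities.ResolutionOfSingularities.Theorems.WildQuotientResolution.JordanFive

variable (k : Type) [Field k] (n : ℕ) (a b c d : Fin n)
  (hab : a ≠ b) (hac : a ≠ c) (had : a ≠ d) (hbc : b ≠ c) (hbd : b ≠ d) (hcd : c ≠ d)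
  (w : Fin n → ZMod 4) (hwa : w a = 1) (hwb : w b = 1) (hwc : w c = 2) (hwd : w d = 3)
  (hw0 : ∀ i, i ≠ a → i ≠ b → i ≠ c → i ≠ d → w i = 0)

include hwa hwb hwc hwd in
/-- A monomial `x_a^i x_b^j x_c^l x_d^m` with `4 ∣ i + j + 2l + 3m` has `μ₄`-weight `0`.
[OURS · L1 W4.5c] -/
theorem isWeightedHomogeneous_zero_of_four_dvd (i j l m : ℕ) (h : 4 ∣ i + j + 2 * l + 3 * m) :
    IsWeightedHomogeneous w (X a ^ i * X b ^ j * X c ^ l * X d ^ m : MvPolynomial (Fin n) k) 0 := by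
  have H := ((((isWeightedHomogeneous_X k w a).pow i).mul ((isWeightedHomogeneous_X k w b).pow j)).mul
    ((isWeightedHomogeneous_X k w c).pow l)).mul ((isWeightedHomogeneous_X k w d).pow m)
  have hwt : i • w a + j • w b + l • w c + m • w d = 0 := by
    rw [hwa, hwb, hwc, hwd]
    simp only [nsmul_eq_mul, mul_one]
    have : ((i + j + 2 * l + 3 * m : ℕ) : ZMod 4) = 0 := (ZMod.natCast_eq_zero_iff _ _).mpr h
    push_cast at this
    linear_combination this
  rwa [hwt] at H

include hab hac had hbc hbd hcd hwa hwb hwc hwd hw0 in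
/-- **(A2) The root images and the generator ratios generate the weight-`0` part** of
`k[x₁,…,xₙ]` for the `μ₄`-weight `w = (1,1,2,3)` on `(a,b,c,d)`: for every `f`,
`f ∈ k[ψ₀(x_i), r_j] ↔ IsWeightedHomogeneous w f 0`. [OURS · L1 W4.5c] -/
theorem adjoin_root5_eq_weightZero (f : MvPolynomial (Fin n) k) :
    f ∈ Algebra.adjoin k
      (Set.range (fun i : Fin n => aeval (fun i : Fin n => if i = a then X a ^ 4
          else if i = b then X a ^ 3 * X b else if i = c then X a ^ 2 * X c
          else if i = d then X a * X d else (X i : MvPolynomial (Fin n) k)) (X i : MvPolynomial (Fin n) k)) ∪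
        Set.range (fun j : Fin 40 => (X a ^ (4 * (exps12 j).1 + 3 * (exps12 j).2.1 +
            2 * (exps12 j).2.2.1 + (exps12 j).2.2.2 - 12) * X b ^ (exps12 j).2.1 *
            X c ^ (exps12 j).2.2.1 * X d ^ (exps12 j).2.2.2 : MvPolynomial (Fin n) k))) ↔
      IsWeightedHomogeneous w f 0 := by
  classical
  -- names
  set G : Set (MvPolynomial (Fin n) k) :=
    Set.range (fun i : Fin n => aeval (fun i : Fin n => if i = a then X a ^ 4
        else if i = b then X a ^ 3 * X b else if i = c then X a ^ 2 * X c
        else if i = d then X a * X d else (X i : MvPolynomial (Fin n) k)) (X i : MvPolynomial (Fin n) k)) ∪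
      Set.range (fun j : Fin 40 => (X a ^ (4 * (exps12 j).1 + 3 * (exps12 j).2.1 +
          2 * (exps12 j).2.2.1 + (exps12 j).2.2.2 - 12) * X b ^ (exps12 j).2.1 *
          X c ^ (exps12 j).2.2.1 * X d ^ (exps12 j).2.2.2 : MvPolynomial (Fin n) k)) with hGdef
  have hroot : ∀ i : Fin n, aeval (fun i : Fin n => if i = a then X a ^ 4
        else if i = b then X a ^ 3 * X b else if i = c then X a ^ 2 * X c
        else if i = d then X a * X d else (X i : MvPolynomial (Fin n) k)) (X i : MvPolynomial (Fin n) k) ∈ Algebra.adjoin k G :=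
    fun i => Algebra.subset_adjoin (Or.inl ⟨i, rfl⟩)
  have hratio : ∀ j : Fin 40, (X a ^ (4 * (exps12 j).1 + 3 * (exps12 j).2.1 +
          2 * (exps12 j).2.2.1 + (exps12 j).2.2.2 - 12) * X b ^ (exps12 j).2.1 *
          X c ^ (exps12 j).2.2.1 * X d ^ (exps12 j).2.2.2 : MvPolynomial (Fin n) k) ∈
        Algebra.adjoin k G :=
    fun j => Algebra.subset_adjoin (Or.inr ⟨j, rfl⟩)
  -- the four root images
  have ha4 : (X a ^ 4 : MvPolynomial (Fin n) k) ∈ Algebra.adjoin k G := by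
    have h := hroot a; rwa [root5_X_a] at h
  have ha3b : (X a ^ 3 * X b : MvPolynomial (Fin n) k) ∈ Algebra.adjoin k G := by
    have h := hroot b; rwa [root5_X_b k n a b c d hab] at h
  have ha2c : (X a ^ 2 * X c : MvPolynomial (Fin n) k) ∈ Algebra.adjoin k G := by
    have h := hroot c; rwa [root5_X_c k n a b c d hac hbc] at h
  have had' : (X a * X d : MvPolynomial (Fin n) k) ∈ Algebra.adjoin k G := by
    have h := hroot d; rwa [root5_X_d k n a b c d had hbd hcd] at h
  have hpass : ∀ i, i ≠ a → i ≠ b → i ≠ c → i ≠ d →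
      (X i : MvPolynomial (Fin n) k) ∈ Algebra.adjoin k G := by
    intro i hia hib hic hid
    have h := hroot i
    rwa [aeval_X, if_neg hia, if_neg hib, if_neg hic, if_neg hid] at h
  -- the nine ratios we need
  have h22 : (X a ^ 2 * X b ^ 2 : MvPolynomial (Fin n) k) ∈ Algebra.adjoin k G := by
    simpa [exps12] using hratio 39
  have h13 : (X a * X b ^ 3 : MvPolynomial (Fin n) k) ∈ Algebra.adjoin k G := by
    simpa [exps12] using hratio 35
  have h04 : (X b ^ 4 : MvPolynomial (Fin n) k) ∈ Algebra.adjoin k G := by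
    simpa [exps12] using hratio 1
  have h111 : (X a * X b * X c : MvPolynomial (Fin n) k) ∈ Algebra.adjoin k G := by
    simpa [exps12] using hratio 34
  have h021 : (X b ^ 2 * X c : MvPolynomial (Fin n) k) ∈ Algebra.adjoin k G := by
    simpa [exps12] using hratio 8
  have h002 : (X c ^ 2 : MvPolynomial (Fin n) k) ∈ Algebra.adjoin k G := by
    simpa [exps12] using hratio 5
  have h0101 : (X b * X d : MvPolynomial (Fin n) k) ∈ Algebra.adjoin k G := by
    simpa [exps12] using hratio 4
  have h0012 : (X c * X d ^ 2 : MvPolynomial (Fin n) k) ∈ Algebra.adjoin k G := by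
    simpa [exps12] using hratio 6
  have h0004 : (X d ^ 4 : MvPolynomial (Fin n) k) ∈ Algebra.adjoin k G := by
    simpa [exps12] using hratio 7
  -- every generator has weight 0
  have hG : ∀ g ∈ G, IsWeightedHomogeneous w g 0 := by
    rintro g (⟨i, rfl⟩ | ⟨j, rfl⟩) <;> dsimp only
    · by_cases hia : i = a
      · subst hia; rw [root5_X_a]
        simpa using isWeightedHomogeneous_zero_of_four_dvd k n i b c d w hwa hwb hwc hwd 4 0 0 0
          (by norm_num)
      by_cases hib : i = b
      · subst hib; rw [root5_X_b k n a i c d hab]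
        simpa using isWeightedHomogeneous_zero_of_four_dvd k n a i c d w hwa hwb hwc hwd 3 1 0 0
          (by norm_num)
      by_cases hic : i = c
      · subst hic; rw [root5_X_c k n a b i d hac hbc]
        simpa using isWeightedHomogeneous_zero_of_four_dvd k n a b i d w hwa hwb hwc hwd 2 0 1 0
          (by norm_num)
      by_cases hid : i = d
      · subst hid; rw [root5_X_d k n a b c i had hbd hcd]
        simpa using isWeightedHomogeneous_zero_of_four_dvd k n a b c i w hwa hwb hwc hwd 1 0 0 1
          (by norm_num)
      · rw [aeval_X, if_neg hia, if_neg hib, if_neg hic, if_neg hid]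
        have h := isWeightedHomogeneous_X k w i
        rwa [hw0 i hia hib hic hid] at h
    · obtain ⟨h12, -, -⟩ := exps12_table j
      exact isWeightedHomogeneous_zero_of_four_dvd k n a b c d w hwa hwb hwc hwd _ _ _ _ (by omega)
  exact Quarter1123.mem_adjoin_iff_isWeightedHomogeneous_zero w hwa hwb hwc hwd hw0 hab hac had hbc
    hbd hcd G hG ha4 ha3b h22 h13 h04 ha2c h111 h021 h002 had' h0101 h0012 h0004 hpass f

end Summit.ResolutionOfSingularities.ResolutionOfSingularities.Theorems.WildQuotientResolution.JordanFive

end
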